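import Literature.MathematicalPhysics.QuantumFieldTheory.Balaban1983to89.B12Eq44Analytic
import Literature.MathematicalPhysics.QuantumFieldTheory.Balaban1983to89.B12Eq313JSlot
import Literature.MathematicalPhysics.QuantumFieldTheory.Balaban1983to89.B12Lemma4Concrete

/-!
# `Balaban1983to89.B12Eq44Space` — T. Bałaban, *Renormalization group approach to lattice gauge field theories. I*,
Commun. Math. Phys. **109** (1987) 249–301 [Balaban1987RG1], p. 281 (4.4): **«we have the function E^{(j)}(X, exp iξ𝐀), i.e. the
function with 𝐔 = 1, 𝐉 = 0. Thus it is defined and analytic on the space of configurations 𝐀 satisfying max{|𝐀|_X, |P₁(□₀)𝐀|_X,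
|∇^ξ𝐀|_X, |Δ^ξ𝐀|_X} < α₂. (4.4)» — PART 2: THE (4.4)-SET, «defined» (the substituted pair `(exp iξ𝐀, J(exp iξ𝐀))` lies in the
CONCRETE space `U^c_j(X, α₀, α₁)` of `B12RegularSpaces111`) and the printed sentence ASSEMBLED with PART 1 (`B12Eq44Analytic`:
the substitution is analytic) from the p. 263 hypothesis «E^{(j)}(X, g, 𝐔, 𝐉) is defined and analytic on the space U^c_j(X, α₀, α₁)».**

HONEST FRAMING (cell `lit-balaban`, verbatim): statement-level skeleton of published theorems with citation tags; proofs where landed; nothing here is a claim about the Yang–Mills mass gap.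

PDF held: `paper:balaban1987-cmp109-rg-i-small-field` (journal page = PDF page + 248); pp. 262–263 [PDF 14–15], 272 [PDF 24] and
281 [PDF 33] re-read by this unit from the text layer (`lit read … --pages 14-16,24-25,33-35`); the letter `|P₁(□₀)𝐀|_X` of (4.4)
(dropped by the text layer) after the render-based quotation in the header of `B12Decay510FromB11`.

WHAT IS REPRODUCED.  SKELETON row `B12.Eq4.4` ((4.4) p. 281; owner cells r09/r20; until now «typed-existing (schematic sup-norm
domination)» — `B12Decay510FromB11.NormDominated`/`supLoc`, an abstract identification of the (4.4)-space) — HERE on the carriers OF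
RECORD: the concrete spaces `B12RegularSpaces111.space′ 𝓜 F c α₀ α₁ = U^c_j(X, α₀, α₁)` (p07 g2), the substitution (3.10)
`B12Eq311CurrentExpansion.sub310 ξ 𝐀 1 = exp iξ𝐀`, the current (1.8)/(1.9) `B12Eq18Current.current`/`ofBackground`, the (3.11)/(3.13)
J-slot calculus of `B12Eq311RemainderBound`/`B12Eq311Landau`/`B12Eq313JSlot` (p07 g7), the plaquette bound of `B12Eq311LatticeBounds`,
the membership mechanism of `B12Lemma4Concrete` (p07 g6) and PART 1 — all BY NAME.

THE PRINT, verbatim.  p. 281 [33]: as in the title.  p. 272 [24]: *«D^{ξ*}_{exp iξ𝐀U} ξ⁻²π Im ∂ exp iξ𝐀U = D^{ξ*}_U ξ⁻²π Im ∂U +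
D^{ξ*}_U D^ξ_U𝐀 + 𝐅(U, 𝐀), (3.11) … We use the fact that 𝐇_j satisfies the Landau gauge condition RD*𝐇_j = 0, and we replace the operator
D*D by D*D + DRD* = D*D + DD* − DPD* = Δ^ξ_U − P₁ + (lower order, local operator). … Thus we obtain the following function of the
variables 𝐔, 𝐉 … (3.13) We consider it on the space U^c_j(X, 1/2α₀, 1/2α₁, α₀) … It is an analytic function on this space, and also
an analytic function of 𝐀, for 𝐀, P^ξ_𝐔𝐀, ∇^ξ_𝐔𝐀, Δ^ξ_𝐔𝐀 sufficiently small. These restrictions can be easily obtained from the definition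
of the spaces, and from the form of the expressions in (3.13). Thus, there exists a constant α₂, depending on α₀ and on some absolute
constants, such that the function (3.13) is analytic in 𝐀, for 𝐀 satisfying the conditions |𝐀|, |P^ξ_𝐔𝐀|, |∇^ξ_𝐔𝐀|, |Δ^ξ_𝐔𝐀| < α₂ on X.
(3.14)»*  p. 263 [15]: *«We assume that the function E^{(j)}(X, g_{j−1}, 𝐔, 𝐉) is defined and analytic on the space U^c_j(X, α₀, α₁)
… It is obvious that for α₀′ sufficiently small the above estimates imply the condition (iv)»*.

THE READING (located; nothing weakened silently).
(a) By (3.11) at `𝐔 = 1` and the printed Landau replacement, for `𝐀` in the Landau gauge `R(ξ⁻¹D^{ξ*}𝐀) = 0` of (180) [15] (the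
configurations `𝐀 = 𝐇_j(□₀, 𝐁)` of (4.2)–(4.3) satisfy it, p. 272), `J(exp iξ𝐀) = π(Δ^ξ𝐀) − π(P₁𝐀) + 𝐅₁(1, 𝐀)` — EXACTLY the 𝐉-slot of
(3.13) at `𝐔 = 1`, `𝐉 = 0` («i.e. the function with 𝐔 = 1, 𝐉 = 0»): `current_sub310_one_landau`.  As in `B12Eq313JSlot` (HONEST SCOPE
(b) there): `Δ^ξ` = `B9Eq352ScalarFluct.siteLap` componentwise inside `π`, `P₁ = D^ξ P ξ⁻¹D^{ξ*}` with `R`, `P` ANY maps of site fields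
with `R + P = I` (the operators of [15] by reference; «P₁(□₀)» = the `P` of the cube `□₀`), and the four (4.4)-quantities are bounded
GLOBALLY (every bond / site of the torus) where the print takes `sup` over `X` — the set `space44`.
(b) «defined» = the substituted pair lies in `U^c_j(X, α₀, α₁)`: conditions (i), (ii) with the trivial factor `U = 1`, `A′ = 𝐀`
(`B12Lemma4Concrete.satisfiesI_III_expI`; `α₂ ≤ α₁`), (iii) from the plaquette deviation of `exp iξ𝐀`
(`B12Eq311LatticeBounds.norm_plaq_prodCfg_sub_one_le` at `U = 1`: `|∂ exp iξ𝐀 − 1| ≤ (2α₂ + 8α₂²e^{4ξα₂})ξ² ≤ 8α₂ξ²` for `α₂ ≤ ¼`,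
`ξ ≤ 1`) and the J-bound `|J(exp iξ𝐀)| < (2 + C_J)α₂ ≤ α₀`, `C_J = (d − 1)Cπ(C_F(1) + 2)` (`B12Eq313JSlot.norm_FOne_le_torus` at `U = 1`);
condition (iv) (1.16) — the background-field functions `U_n(M˙(·))`, `J_n(M˙(·))` are DATA (`Frame.bg`) — stays a hypothesis exactly as
in `B12Lemma4Concrete.expI_mem_space` (p. 263, Proposition 9 [15] by reference, row `B12.Eq1.17`).
(c) «α₂, depending on α₀ and on some absolute constants» = the explicit restrictions `0 ≤ α₂ ≤ ¼`, `α₂ ≤ α₁`, `8α₂ < α₀`,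
`(2 + C_J)α₂ ≤ α₀` (`0 < α₀ ≤ 1`, `0 < ξ ≤ 1`).
(d) `𝔸` is a complete normed `ℂ`-algebra with `‖1‖ = 1` (`NormOneClass`: the matrix algebras of the models `B12RegularSpaces111Unitary` /
`…SpecialUnitary`); `π` the printed projection onto `𝔤ᶜ` with `‖πX‖ ≤ Cπ‖X‖` (no commutation with transports is needed at `𝐔 = 1`);
`exp iξ·` maps `𝔤ᶜ` into `Gᶜ` and `𝔤ᶜ` is `Ad(Gᶜ)`-stable (so that `J ∈ 𝔤ᶜ`, `B12Eq18Current.current_mem_gc`).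

WHAT IS PROVED (ONE definition `space44` = the (4.4)-set, and theorems; 0 sorry, 0 new facts, axioms standard).  §1 `space44`,
`mem_space44_iff`, the `𝐔 = 1` dictionary `imPlaq_one`, **`current_one`** (`J(1) = 0`) (+ private plumbing: unit plaquettes,
transports, norms).  §2 (iii) for `exp iξ𝐀`: `norm_plaq_sub310_one_sub_one_le` / **`norm_plaq_sub310_one_sub_one_lt`**.  §3 the J-slot at
`𝐔 = 1`: **`current_sub310_one_landau`** ((3.13) at `(1, 0)`), **`norm_current_sub310_one_lt`**.  §4 «defined»: `satisfies_sub310_one`,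
**`ofBackground_sub310_one_mem_space'`**.  §5 the printed sentence: **`analyticOnNhd_E_sub310_one`** — under the p. 263 hypothesis on
`E` and (c), `𝐀 ↦ E(exp iξ𝐀, J(exp iξ𝐀))` is analytic at every `𝔤ᶜ`-valued Landau-gauge `𝐀` of the (4.4)-set (given (iv) there).
NOT here: the (3.13)/(3.14) statement at a general `(𝐔, 𝐉)` (needs the (ii)-slot of the product `exp iξ𝐀·exp iξA′·U`,
`B12Membership313II*`), the identification of `P`, `R` with the operators of [15], the gauge step (4.2) (row `B12.Eq4.2-4.3`),
(4.3)/(4.5) (`B12Repr43`, `B12Ineq45`, `B12Decay510*`).  Unit `lit-balaban-p05` (Phase-2 seat p05 gen 7; free-target protocol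
G.5-34(d); TAKING line HOME/STATUS.md 2026-08-21T18:39:05Z; owners r09/r20, referee ref-5), HOME `run/shared/lean/pub/lit-balaban/`.
-/

open NormedSpace Complex

namespace Literature.MathematicalPhysics.QuantumFieldTheory.Balaban1983to89.B12Eq44Space

open Literature.MathematicalPhysics.QuantumFieldTheory.Balaban1983to89
open Literature.MathematicalPhysics.QuantumFieldTheory.Balaban1983to89.B9Eq37Insertion
open Literature.MathematicalPhysics.QuantumFieldTheory.Balaban1983to89.B9Eq39Adjoint
open Literature.MathematicalPhysics.QuantumFieldTheory.Balaban1983to89.B9TorusCalculus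
open Literature.MathematicalPhysics.QuantumFieldTheory.Balaban1983to89.B9Eq352ScalarFluct (siteLap)
open Literature.MathematicalPhysics.QuantumFieldTheory.Balaban1983to89.B9Eq3117Current (covDη)
open Literature.MathematicalPhysics.QuantumFieldTheory.Balaban1983to89.B11Eq135Weitzenbock (curvOp)
open Literature.MathematicalPhysics.QuantumFieldTheory.Balaban1983to89.B12RegularSpaces111
open Literature.MathematicalPhysics.QuantumFieldTheory.Balaban1983to89.B12RegularSpaces111Mono
open Literature.MathematicalPhysics.QuantumFieldTheory.Balaban1983to89.B12Eq18Current
open Literature.MathematicalPhysics.QuantumFieldTheory.Balaban1983to89.B12Eq311CurrentExpansion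
open Literature.MathematicalPhysics.QuantumFieldTheory.Balaban1983to89.B12Eq311RemainderBound
open Literature.MathematicalPhysics.QuantumFieldTheory.Balaban1983to89.B12Eq313JSlot
open Literature.MathematicalPhysics.QuantumFieldTheory.Balaban1983to89.B12Eq44Analytic
open Literature.MathematicalPhysics.QuantumFieldTheory.Balaban1983to89.B9Eq369Product (norm_eta_inv_smul_le_iff)

noncomputable section

variable {P : Params} {i : ℕ} {𝔸 : Type*} [NormedRing 𝔸] [NormedAlgebra ℂ 𝔸] [CompleteSpace 𝔸]

/-! ## §1. The (4.4)-set and the `𝐔 = 1` dictionary -/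

/-- **The (4.4)-set**: the configurations `𝐀` with `max{|𝐀|, |P₁𝐀|, |∇^ξ𝐀|, |Δ^ξ𝐀|} < α₂` — `|∇^ξ𝐀|` the flat `ξ`-derivative
(`B12RegularSpaces111.grad`), `|Δ^ξ𝐀|` = `π(siteLap 𝐀_μ)` at the flat background, `|P₁𝐀|` = `π(D^ξ P ξ⁻¹D^{ξ*}𝐀)` for a map `P` of
site fields (the letters of `B12Eq313JSlot.jSlot_norm_lt` at `𝐔 = 1`); the bounds GLOBAL on the torus where the print takes the `sup`
over `X` (READING (a) of the header). [cite: Balaban1987RG1, (4.4) p.281] -/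
def space44 (π : 𝔸 →ₗ[ℂ] 𝔸) (Pop : (Site P i → 𝔸) → (Site P i → 𝔸)) (ξ α₂ : ℝ) : Set (PBond P i → 𝔸) :=
  {A | (∀ b, ‖A b‖ < α₂) ∧ (∀ (μ ν : Fin P.d) (x : Site P i), ‖grad ξ μ (fun y => A ⟨y, ν⟩) x‖ < α₂) ∧
    (∀ b : PBond P i,
      ‖π (siteLap (torusT P i) (dirForm (1 : PBond P i → 𝔸ˣ)) ξ (dirForm A b.dir) b.src)‖ < α₂) ∧
    (∀ b : PBond P i,
      ‖π (covDη (torusT P i) (dirForm (1 : PBond P i → 𝔸ˣ)) ξ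
          (Pop (fun y => ((ξ : ℂ)⁻¹) • divB (torusT P i) (dirForm (1 : PBond P i → 𝔸ˣ)) (dirForm A) y))
          b.dir b.src)‖ < α₂)}

omit [CompleteSpace 𝔸] in
/-- Membership in the (4.4)-set, unfolded. [cite: Balaban1987RG1, (4.4) p.281] -/
theorem mem_space44_iff (π : 𝔸 →ₗ[ℂ] 𝔸) (Pop : (Site P i → 𝔸) → (Site P i → 𝔸)) (ξ α₂ : ℝ) (A : PBond P i → 𝔸) :
    A ∈ space44 π Pop ξ α₂ ↔
      (∀ b, ‖A b‖ < α₂) ∧ (∀ (μ ν : Fin P.d) (x : Site P i), ‖grad ξ μ (fun y => A ⟨y, ν⟩) x‖ < α₂) ∧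
      (∀ b : PBond P i,
        ‖π (siteLap (torusT P i) (dirForm (1 : PBond P i → 𝔸ˣ)) ξ (dirForm A b.dir) b.src)‖ < α₂) ∧
      (∀ b : PBond P i,
        ‖π (covDη (torusT P i) (dirForm (1 : PBond P i → 𝔸ˣ)) ξ
            (Pop (fun y => ((ξ : ℂ)⁻¹) • divB (torusT P i) (dirForm (1 : PBond P i → 𝔸ˣ)) (dirForm A) y))
            b.dir b.src)‖ < α₂) :=
  Iff.rfl

omit [NormedAlgebra ℂ 𝔸] [CompleteSpace 𝔸] in
/-- The unit configuration in the direction-indexed dictionary is the constant family `1`. [folklore] -/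
private theorem dirForm_one : dirForm (1 : PBond P i → 𝔸ˣ) = fun _ _ => 1 := rfl

omit [NormedAlgebra ℂ 𝔸] [CompleteSpace 𝔸] in
/-- The plaquette variables of the unit configuration are `1`. [folklore] -/
private theorem plaqU_one (μ ν : Fin P.d) (x : Site P i) :
    plaqU (torusT P i) (dirForm (1 : PBond P i → 𝔸ˣ)) μ ν x = 1 := by
  simp [plaqU, dirForm]

omit [CompleteSpace 𝔸] in
/-- `ξ⁻²π Im ∂1 = 0`: the plaquette function of (1.8) vanishes at the unit configuration. [cite: Balaban1987RG1, (1.8) p.261] -/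
theorem imPlaq_one (π : 𝔸 →ₗ[ℂ] 𝔸) (ξ : ℝ) : imPlaq π ξ (1 : PBond P i → 𝔸ˣ) = fun _ _ _ => 0 := by
  funext μ ν x
  simp [imPlaq, plaqU_one, imC]

omit [NormedAlgebra ℂ 𝔸] [CompleteSpace 𝔸] in
/-- `D*` of the zero plaquette function vanishes. [folklore] -/
private theorem divP_zero_fun (V : Fin P.d → Site P i → 𝔸ˣ) (μ : Fin P.d) (x : Site P i) :
    divP (torusT P i) V (fun _ _ _ => (0 : 𝔸)) μ x = 0 := by
  simp [divP, covDstar, R]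

omit [CompleteSpace 𝔸] in
/-- **`J(1) = 0`**: the current (1.8) of the unit configuration vanishes («the function with 𝐔 = 1, 𝐉 = 0»: at `𝐔 = 1` the first term
`D^{ξ*}_U ξ⁻²π Im ∂U` of (3.11) is absent). [cite: Balaban1987RG1, (1.8) p.261] -/
theorem current_one (π : 𝔸 →ₗ[ℂ] 𝔸) (ξ : ℝ) (b : PBond P i) : current π ξ (1 : PBond P i → 𝔸ˣ) b = 0 := by
  rw [current_apply, imPlaq_one, divP_zero_fun, smul_zero]

omit [NormedAlgebra ℂ 𝔸] [CompleteSpace 𝔸] in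
/-- The transport by the unit bond variable is the identity: `R(1)⁻¹X = X`. [folklore] -/
private theorem R_one_inv (X : 𝔸) : R (1 : 𝔸ˣ)⁻¹ X = X := by
  simp [R]

omit [CompleteSpace 𝔸] in
/-- At `𝐔 = 1` every `π` «commutes with the transports» (there are none). [folklore] -/
private theorem pi_R_one (π : 𝔸 →ₗ[ℂ] 𝔸) (b : PBond P i) (X : 𝔸) :
    π (R ((1 : PBond P i → 𝔸ˣ) b)⁻¹ X) = R ((1 : PBond P i → 𝔸ˣ) b)⁻¹ (π X) := by
  rw [Pi.one_apply, R_one_inv, R_one_inv]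

omit [NormedAlgebra ℂ 𝔸] [CompleteSpace 𝔸] in
/-- The unit configuration is a `ρ = 1` background when `‖1‖ = 1`. [folklore] -/
private theorem norm_one_cfg_le [NormOneClass 𝔸] (b : PBond P i) :
    ‖((1 : PBond P i → 𝔸ˣ) b : 𝔸)‖ ≤ 1 ∧ ‖((((1 : PBond P i → 𝔸ˣ) b)⁻¹ : 𝔸ˣ) : 𝔸)‖ ≤ 1 := by
  simp

/-! ## §2. Condition (iii) for `exp iξ𝐀`: the plaquette deviation -/

section Plaquette

variable [NormOneClass 𝔸]

/-- **`|∂ exp iξ𝐀 − 1| ≤ (2α₂ + 8α₂²e^{4ξα₂})ξ²`** at every plaquette, from `|𝐀| ≤ α₂`, `|∇^ξ𝐀| ≤ α₂` (global): the plaquette deviation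
of `U′ = e^{iξ𝐀}·1` by `B12Eq311LatticeBounds.norm_plaq_prodCfg_sub_one_le` (there for `e^{iξ𝐀}U` on a `ρ`-background with `|∂U − 1| ≤ ε`;
here `U = 1`, `ρ = 1`, `ε = 0`). [cite: Balaban1987RG1, (1.14) p.262 with (4.4) p.281] -/
theorem norm_plaq_sub310_one_sub_one_le {ξ α₂ : ℝ} (hξ : 0 < ξ) {A : PBond P i → 𝔸} (hA : ∀ b, ‖A b‖ ≤ α₂)
    (hDA : ∀ (μ ν : Fin P.d) (x : Site P i), ‖grad ξ μ (fun y => A ⟨y, ν⟩) x‖ ≤ α₂) (p : Plaq P i) :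
    ‖((plaq (sub310 ξ A (1 : PBond P i → 𝔸ˣ)) p : 𝔸ˣ) : 𝔸) - 1‖
      ≤ ξ ^ 2 * (2 * α₂ + 1 / 2 * (2 * (1 + 1 ^ 2) * α₂) ^ 2 * Real.exp (ξ * (2 * (1 + 1 ^ 2) * α₂))) := by
  have hU : ∀ (μ : Fin P.d) (x : Site P i), ‖((dirForm (1 : PBond P i → 𝔸ˣ) μ x : 𝔸ˣ) : 𝔸)‖ ≤ 1 ∧
      ‖(((dirForm (1 : PBond P i → 𝔸ˣ) μ x)⁻¹ : 𝔸ˣ) : 𝔸)‖ ≤ 1 := fun μ x => norm_one_cfg_le ⟨x, μ⟩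
  have hDA' : ∀ (κ ν : Fin P.d) (y : Site P i),
      ‖covD (torusT P i) (dirForm (1 : PBond P i → 𝔸ˣ)) κ (dirForm A ν) y‖ ≤ ξ * α₂ := fun κ ν y =>
    (norm_eta_inv_smul_le_iff hξ _).mp (by
      rw [← nabla_eq_smul_covD, nabla_one]
      exact hDA κ ν y)
  have h := B12Eq311LatticeBounds.norm_plaq_prodCfg_sub_one_le (torusT P i) (dirForm (1 : PBond P i → 𝔸ˣ))
    (A := dirForm A) (ε := 0) hξ hU (fun μ x => hA ⟨x, μ⟩) hDA' p.μ p.ν p.src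
    (by rw [plaqU_one, Units.val_one, sub_self, norm_zero])
  rw [plaq_eq_plaqU, dirForm_sub310]
  calc _ ≤ _ := h
    _ = _ := by rw [zero_div, mul_zero, add_zero]

/-- **Condition (iii), first clause, for `exp iξ𝐀`**: `|∂ exp iξ𝐀 − 1| < α₀ξ²` at every plaquette, for `𝐀` with `|𝐀| < α₂`,
`|∇^ξ𝐀| < α₂`, under the restrictions `0 < ξ ≤ 1`, `0 ≤ α₂ ≤ ¼`, `8α₂ < α₀` (`e^{4ξα₂} ≤ e ≤ 3`, so the bound above is `≤ 8α₂ξ²`).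
[cite: Balaban1987RG1, (1.14) p.262 with (4.4) p.281] -/
theorem norm_plaq_sub310_one_sub_one_lt {ξ α₂ α₀ : ℝ} (hξ : 0 < ξ) (hξ1 : ξ ≤ 1) (hα₂ : 0 ≤ α₂) (hα₂q : α₂ ≤ 1 / 4)
    (h8 : 8 * α₂ < α₀) {A : PBond P i → 𝔸} (hA : ∀ b, ‖A b‖ < α₂)
    (hDA : ∀ (μ ν : Fin P.d) (x : Site P i), ‖grad ξ μ (fun y => A ⟨y, ν⟩) x‖ < α₂) (p : Plaq P i) :
    ‖((plaq (sub310 ξ A (1 : PBond P i → 𝔸ˣ)) p : 𝔸ˣ) : 𝔸) - 1‖ < α₀ * ξ ^ 2 := by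
  have h := norm_plaq_sub310_one_sub_one_le hξ (fun b => (hA b).le) (fun μ ν x => (hDA μ ν x).le) p
  have hexp : Real.exp (ξ * (2 * (1 + 1 ^ 2) * α₂)) ≤ 3 := by
    have h1 : ξ * (2 * (1 + 1 ^ 2) * α₂) ≤ 1 := by nlinarith
    have h2 : Real.exp (ξ * (2 * (1 + 1 ^ 2) * α₂)) ≤ Real.exp 1 := Real.exp_le_exp.mpr h1
    have h3 : Real.exp 1 < 2.7182818286 := Real.exp_one_lt_d9
    linarith
  have hξ2 : 0 < ξ ^ 2 := pow_pos hξ 2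
  have key : 2 * α₂ + 1 / 2 * (2 * (1 + 1 ^ 2) * α₂) ^ 2 * Real.exp (ξ * (2 * (1 + 1 ^ 2) * α₂)) ≤ 8 * α₂ := by
    have h4 : 1 / 2 * (2 * (1 + 1 ^ 2) * α₂) ^ 2 * Real.exp (ξ * (2 * (1 + 1 ^ 2) * α₂))
        ≤ 1 / 2 * (2 * (1 + 1 ^ 2) * α₂) ^ 2 * 3 :=
      mul_le_mul_of_nonneg_left hexp (by positivity)
    nlinarith
  calc _ ≤ ξ ^ 2 * (2 * α₂ + 1 / 2 * (2 * (1 + 1 ^ 2) * α₂) ^ 2 * Real.exp (ξ * (2 * (1 + 1 ^ 2) * α₂))) := h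
    _ ≤ ξ ^ 2 * (8 * α₂) := mul_le_mul_of_nonneg_left key hξ2.le
    _ < ξ ^ 2 * α₀ := mul_lt_mul_of_pos_left h8 hξ2
    _ = α₀ * ξ ^ 2 := mul_comm _ _

end Plaquette

/-! ## §3. The 𝐉-slot of (3.13) at `𝐔 = 1`: `J(exp iξ𝐀) = π(Δ^ξ𝐀) − π(P₁𝐀) + 𝐅₁(1, 𝐀)` and its bound -/

section JSlot

variable [NormOneClass 𝔸]

omit [NormOneClass 𝔸] in
/-- OUR absolute constant `C_F(1)` of the (3.11)-remainder bound is nonnegative. [folklore] -/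
private theorem C311_one_nonneg : 0 ≤ C311 (1 : ℝ) := by
  unfold C311 KI KQ KR
  positivity

omit [NormOneClass 𝔸] in
/-- **(3.11) at `𝐔 = 1` with the printed Landau replacement = the 𝐉-slot of (3.13) at `(𝐔, 𝐉) = (1, 0)`**: for `𝐀` in the Landau
gauge `R(ξ⁻¹D^{ξ*}𝐀) = 0` (`R + P = I`), `J(exp iξ𝐀)(b) = π(Δ^ξ𝐀)(b) − π(P₁𝐀)(b) + [𝐅(1, 𝐀)(b) − π(ξ⁻²𝒦𝐀)(b)]` — `B12Eq313JSlot.current_sub310_landau`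
at `U = 1` with `J(1) = 0`. [cite: Balaban1987RG1, (3.10)-(3.13) p.272] -/
theorem current_sub310_one_landau (π : 𝔸 →ₗ[ℂ] 𝔸) (ξ : ℝ) (A : PBond P i → 𝔸)
    (Rop Pop : (Site P i → 𝔸) → (Site P i → 𝔸)) (hRP : ∀ f : Site P i → 𝔸, Rop f + Pop f = f)
    (hL : Rop (fun y => ((ξ : ℂ)⁻¹) •
      divB (torusT P i) (dirForm (1 : PBond P i → 𝔸ˣ)) (dirForm A) y) = 0) (b : PBond P i) :
    current π ξ (sub310 ξ A (1 : PBond P i → 𝔸ˣ)) b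
      = π (siteLap (torusT P i) (dirForm (1 : PBond P i → 𝔸ˣ)) ξ (dirForm A b.dir) b.src)
        - π (covDη (torusT P i) (dirForm (1 : PBond P i → 𝔸ˣ)) ξ
              (Pop (fun y => ((ξ : ℂ)⁻¹) • divB (torusT P i) (dirForm (1 : PBond P i → 𝔸ˣ)) (dirForm A) y))
              b.dir b.src)
        + (rem311 π ξ (1 : PBond P i → 𝔸ˣ) A b
            - π ((((ξ : ℂ)⁻¹) ^ 2) • curvOp (torusT P i) (dirForm (1 : PBond P i → 𝔸ˣ)) (dirForm A)
                b.dir b.src)) := by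
  rw [B12Eq313JSlot.current_sub310_landau π ξ 1 A (pi_R_one π) Rop Pop hRP hL b, current_one, zero_add]

/-- **`|J(exp iξ𝐀)| < α₀`** — the 𝐉-slot bound of (3.13)/(3.14) at `(𝐔, 𝐉) = (1, 0)`: for `𝐀` in the (4.4)-set (GLOBAL letters, `α₂ ≤ 1`)
in the Landau gauge, `‖πX‖ ≤ Cπ‖X‖`, `0 < ξ ≤ 1`, `0 ≤ α₀ ≤ 1` and the restriction `(2 + C_J)α₂ ≤ α₀`, `C_J = (d − 1)·Cπ·(C_F(1) + 2)`
(`C_F = B12Eq311CurrentExpansion.C311`): `π(Δ^ξ𝐀)`, `π(P₁𝐀)` contribute `< α₂` each and `𝐅₁(1, 𝐀)` at most `C_J·α₂`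
(`B12Eq313JSlot.norm_FOne_le_torus` at `U = 1`). [cite: Balaban1987RG1, (3.13)-(3.14) p.272 with (1.14) p.262] -/
theorem norm_current_sub310_one_lt {π : 𝔸 →ₗ[ℂ] 𝔸} {Rop Pop : (Site P i → 𝔸) → (Site P i → 𝔸)} {ξ α₂ α₀ Cπ : ℝ}
    (hξ : 0 < ξ) (hξ1 : ξ ≤ 1) (hα₀ : 0 ≤ α₀) (hα₀1 : α₀ ≤ 1) (hα₂1 : α₂ ≤ 1) (hCπ : 0 ≤ Cπ)
    (hπn : ∀ X, ‖π X‖ ≤ Cπ * ‖X‖) (hRP : ∀ f : Site P i → 𝔸, Rop f + Pop f = f)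
    (hres : (2 + (P.d - 1) * (Cπ * (C311 1 + 2 * 1 ^ 14))) * α₂ ≤ α₀)
    {A : PBond P i → 𝔸} (hA : A ∈ space44 π Pop ξ α₂)
    (hL : Rop (fun y => ((ξ : ℂ)⁻¹) •
      divB (torusT P i) (dirForm (1 : PBond P i → 𝔸ˣ)) (dirForm A) y) = 0) (b : PBond P i) :
    ‖current π ξ (sub310 ξ A (1 : PBond P i → 𝔸ˣ)) b‖ < α₀ := by
  obtain ⟨hA0, hA1, hΔ, hP₁⟩ := hA
  have hF := B12Eq313JSlot.norm_FOne_le_torus (P := P) (i := i) (U := (1 : PBond P i → 𝔸ˣ)) (A := A) (π := π)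
    (ρ := 1) hξ hξ1 le_rfl norm_one_cfg_le hα₀ hα₀1 hα₂1 (fun b => (hA0 b).le)
    (fun μ ν x => by rw [nabla_one]; exact (hA1 μ ν x).le)
    (fun p => by rw [plaq_one, Units.val_one, sub_self, norm_zero]; positivity) hCπ hπn (pi_R_one π) b
  rw [current_sub310_one_landau π ξ A Rop Pop hRP hL b]
  have hd : (0 : ℝ) ≤ (P.d - 1 : ℝ) * (Cπ * (C311 1 + 2 * 1 ^ 14)) * α₂ := by
    have h1 : (1 : ℝ) ≤ P.d := by exact_mod_cast P.hd
    have h2 : 0 ≤ C311 (1 : ℝ) := C311_one_nonneg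
    have hα₂ : 0 ≤ α₂ := (norm_nonneg _).trans (hA0 b).le
    have : (0 : ℝ) ≤ P.d - 1 := by linarith
    positivity
  calc ‖π (siteLap (torusT P i) (dirForm (1 : PBond P i → 𝔸ˣ)) ξ (dirForm A b.dir) b.src)
        - π (covDη (torusT P i) (dirForm (1 : PBond P i → 𝔸ˣ)) ξ
              (Pop (fun y => ((ξ : ℂ)⁻¹) • divB (torusT P i) (dirForm (1 : PBond P i → 𝔸ˣ)) (dirForm A) y))
              b.dir b.src)
        + (rem311 π ξ (1 : PBond P i → 𝔸ˣ) A b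
            - π ((((ξ : ℂ)⁻¹) ^ 2) • curvOp (torusT P i) (dirForm (1 : PBond P i → 𝔸ˣ)) (dirForm A)
                b.dir b.src))‖
      ≤ ‖π (siteLap (torusT P i) (dirForm (1 : PBond P i → 𝔸ˣ)) ξ (dirForm A b.dir) b.src)‖
        + ‖π (covDη (torusT P i) (dirForm (1 : PBond P i → 𝔸ˣ)) ξ
              (Pop (fun y => ((ξ : ℂ)⁻¹) • divB (torusT P i) (dirForm (1 : PBond P i → 𝔸ˣ)) (dirForm A) y))
              b.dir b.src)‖
        + ‖rem311 π ξ (1 : PBond P i → 𝔸ˣ) A b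
            - π ((((ξ : ℂ)⁻¹) ^ 2) • curvOp (torusT P i) (dirForm (1 : PBond P i → 𝔸ˣ)) (dirForm A)
                b.dir b.src)‖ := norm_add_le_of_le (norm_sub_le _ _) le_rfl
    _ < α₂ + α₂ + (P.d - 1) * (Cπ * (C311 1 + 2 * 1 ^ 14) * α₂) := by
        have h3 := hΔ b
        have h4 := hP₁ b
        linarith
    _ = (2 + (P.d - 1) * (Cπ * (C311 1 + 2 * 1 ^ 14))) * α₂ := by ring
    _ ≤ α₀ := hres

end JSlot

/-! ## §4. «defined»: the pair `(exp iξ𝐀, J(exp iξ𝐀))` lies in `U^c_j(X, α₀, α₁)` -/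

section Defined

variable [NormOneClass 𝔸] (𝓜 : Model 𝔸)

/-- **Conditions (i)–(iv) for the substituted pair `(exp iξ𝐀, J(exp iξ𝐀))`** («defined … on the space of configurations 𝐀 satisfying (4.4)»,
READING (c)): `U = 1`, `A′ = 𝐀` for (i)/(ii) (`α₂ ≤ α₁`), (iii) from §2 and §3, (iv) as data hypotheses; `𝐀` `𝔤ᶜ`-valued, `exp iξ·: 𝔤ᶜ → Gᶜ`,
`π` onto `𝔤ᶜ`, `𝔤ᶜ` `Ad(Gᶜ)`-stable. [cite: Balaban1987RG1, (4.4) p.281 with (1.11)-(1.16) p.262] -/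
theorem satisfies_sub310_one {F : Frame P i 𝔸} {c : StepConsts} {π : 𝔸 →ₗ[ℂ] 𝔸}
    {Rop Pop : (Site P i → 𝔸) → (Site P i → 𝔸)} {α₀ α₁ α₂ Cπ : ℝ}
    (hξ : 0 < c.ξ) (hξ1 : c.ξ ≤ 1) (hcB : 0 < c.cB) (hα₀ : 0 < α₀) (hα₀1 : α₀ ≤ 1) (hα₂ : 0 ≤ α₂)
    (hα₂q : α₂ ≤ 1 / 4) (hα₂α₁ : α₂ ≤ α₁) (h8 : 8 * α₂ < α₀) (hCπ : 0 ≤ Cπ) (hπn : ∀ X, ‖π X‖ ≤ Cπ * ‖X‖)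
    (hπgc : ∀ X, π X ∈ 𝓜.gc) (hgcAd : ∀ g ∈ 𝓜.Gc, ∀ X ∈ 𝓜.gc, R g X ∈ 𝓜.gc) (heGc : ∀ a ∈ 𝓜.gc, expI c.ξ a ∈ 𝓜.Gc)
    (hRP : ∀ f : Site P i → 𝔸, Rop f + Pop f = f)
    (hres : (2 + (P.d - 1) * (Cπ * (C311 1 + 2 * 1 ^ 14))) * α₂ ≤ α₀)
    {A : PBond P i → 𝔸} (hA : A ∈ space44 π Pop c.ξ α₂) (hAgc : ∀ b, A b ∈ 𝓜.gc)
    (hL : Rop (fun y => ((c.ξ : ℂ)⁻¹) •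
      divB (torusT P i) (dirForm (1 : PBond P i → 𝔸ˣ)) (dirForm A) y) = 0)
    (hIV : CondIV F.bg F.X₂ c α₀ (sub310 c.ξ A (1 : PBond P i → 𝔸ˣ)))
    (hIV₁ : CondIV F.bg F.X₂ c α₀ (1 : PBond P i → 𝔸ˣ)) :
    Satisfies 𝓜 F c α₀ α₁ α₀ (ofBackground π c.ξ (sub310 c.ξ A (1 : PBond P i → 𝔸ˣ))) := by
  obtain ⟨hA0, hA1, hΔ, hP₁⟩ := hA
  have hUgc : ∀ b, sub310 c.ξ A (1 : PBond P i → 𝔸ˣ) b ∈ 𝓜.Gc := fun b => by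
    rw [sub310_one_apply]; exact heGc _ (hAgc b)
  have hJgc : ∀ b, current π c.ξ (sub310 c.ξ A (1 : PBond P i → 𝔸ˣ)) b ∈ 𝓜.gc := fun b =>
    current_mem_gc 𝓜 π hπgc hgcAd c.ξ hUgc b
  have hJ : ∀ b, ‖current π c.ξ (sub310 c.ξ A (1 : PBond P i → 𝔸ˣ)) b‖ < α₀ := fun b =>
    norm_current_sub310_one_lt hξ hξ1 hα₀.le hα₀1 (by linarith) hCπ hπn hRP hres ⟨hA0, hA1, hΔ, hP₁⟩ hL b
  have hplaq : ∀ p ∈ F.X.plaqs, ‖((plaq (fun b => expI c.ξ (A b)) p : 𝔸ˣ) : 𝔸) - 1‖ < α₀ * c.ξ ^ 2 := fun p _ => by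
    rw [← sub310_one_eq]
    exact norm_plaq_sub310_one_sub_one_lt hξ hξ1 hα₂ hα₂q h8 hA0 hA1 p
  have h3 : SatisfiesI_III 𝓜 F c α₀ α₁ α₀
      ⟨fun b => expI c.ξ (A b), current π c.ξ (sub310 c.ξ A (1 : PBond P i → 𝔸ˣ))⟩ :=
    B12Lemma4Concrete.satisfiesI_III_expI 𝓜 hξ hcB hα₀ heGc (fun b _ => hAgc b) (fun b _ => hJgc b)
      (fun b _ => (hA0 b).trans_le hα₂α₁) (fun q _ => (hA1 q.2.1 q.2.2 q.1).trans_le hα₂α₁) hplaq (fun b _ => hJ b)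
  have hpair : ofBackground π c.ξ (sub310 c.ξ A (1 : PBond P i → 𝔸ˣ))
      = ⟨fun b => expI c.ξ (A b), current π c.ξ (sub310 c.ξ A (1 : PBond P i → 𝔸ˣ))⟩ := by
    rw [← sub310_one_eq]; rfl
  rw [hpair]
  obtain ⟨hG, hg, U, A', hf, h1, h2, hc3⟩ := h3
  refine ⟨hG, hg, 1, A, B12Lemma4Concrete.factors_expI_one c A, condI_one F hξ.ne' hcB hα₀, ?_, ?_, ?_, hIV₁⟩
  · exact B12Lemma4Concrete.condII_one 𝓜 (fun b _ => hAgc b) (fun b _ => (hA0 b).trans_le hα₂α₁)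
      (fun q _ => (hA1 q.2.1 q.2.2 q.1).trans_le hα₂α₁)
  · exact ⟨hplaq, fun b _ => hJ b⟩
  · simpa only [sub310_one_eq] using hIV

/-- **«defined»: `(exp iξ𝐀, J(exp iξ𝐀)) ∈ U^c_j(X, α₀, α₁)`** for `𝔤ᶜ`-valued Landau-gauge `𝐀` in the (4.4)-set, under the restrictions
of READING (d) and condition (iv) for `exp iξ𝐀` (and for `1`) as data hypotheses. [cite: Balaban1987RG1, (4.4) p.281] -/
theorem ofBackground_sub310_one_mem_space' {F : Frame P i 𝔸} {c : StepConsts} {π : 𝔸 →ₗ[ℂ] 𝔸}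
    {Rop Pop : (Site P i → 𝔸) → (Site P i → 𝔸)} {α₀ α₁ α₂ Cπ : ℝ}
    (hξ : 0 < c.ξ) (hξ1 : c.ξ ≤ 1) (hcB : 0 < c.cB) (hα₀ : 0 < α₀) (hα₀1 : α₀ ≤ 1) (hα₂ : 0 ≤ α₂)
    (hα₂q : α₂ ≤ 1 / 4) (hα₂α₁ : α₂ ≤ α₁) (h8 : 8 * α₂ < α₀) (hCπ : 0 ≤ Cπ) (hπn : ∀ X, ‖π X‖ ≤ Cπ * ‖X‖)
    (hπgc : ∀ X, π X ∈ 𝓜.gc) (hgcAd : ∀ g ∈ 𝓜.Gc, ∀ X ∈ 𝓜.gc, R g X ∈ 𝓜.gc) (heGc : ∀ a ∈ 𝓜.gc, expI c.ξ a ∈ 𝓜.Gc)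
    (hRP : ∀ f : Site P i → 𝔸, Rop f + Pop f = f)
    (hres : (2 + (P.d - 1) * (Cπ * (C311 1 + 2 * 1 ^ 14))) * α₂ ≤ α₀)
    {A : PBond P i → 𝔸} (hA : A ∈ space44 π Pop c.ξ α₂) (hAgc : ∀ b, A b ∈ 𝓜.gc)
    (hL : Rop (fun y => ((c.ξ : ℂ)⁻¹) •
      divB (torusT P i) (dirForm (1 : PBond P i → 𝔸ˣ)) (dirForm A) y) = 0)
    (hIV : CondIV F.bg F.X₂ c α₀ (sub310 c.ξ A (1 : PBond P i → 𝔸ˣ)))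
    (hIV₁ : CondIV F.bg F.X₂ c α₀ (1 : PBond P i → 𝔸ˣ)) :
    ofBackground π c.ξ (sub310 c.ξ A (1 : PBond P i → 𝔸ˣ)) ∈ space' 𝓜 F c α₀ α₁ :=
  mem_space_of_satisfies (satisfies_sub310_one 𝓜 hξ hξ1 hcB hα₀ hα₀1 hα₂ hα₂q hα₂α₁ h8 hCπ hπn hπgc hgcAd heGc hRP
    hres hA hAgc hL hIV hIV₁)

end Defined

/-! ## §5. The printed sentence: «defined and analytic on the space of configurations 𝐀 satisfying (4.4)» -/

section Sentence

variable [NormOneClass 𝔸] {V : Type*} [NormedAddCommGroup V] [NormedSpace ℂ V]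

/-- **[B12 (4.4)] «Thus it is defined and analytic on the space of configurations 𝐀 satisfying (4.4)»** — ON THE CONCRETE SPACES: let
`E : (bonds → 𝔸) × (bonds → 𝔸) → V` be analytic at every point of `U^c_j(X, α₀, α₁)` (the p. 263 hypothesis, READING (b)), `π` the
projection onto `𝔤ᶜ` with `‖πX‖ ≤ Cπ‖X‖`, `exp iξ·: 𝔤ᶜ → Gᶜ`, `𝔤ᶜ` `Ad(Gᶜ)`-stable, `0 < ξ ≤ 1`, `O(1)LMB > 0`, `0 < α₀ ≤ 1`,
`0 ≤ α₂ ≤ min{¼, α₁}`, `8α₂ < α₀`, `(2 + C_J)α₂ ≤ α₀`, and let condition (iv) hold (data) for `exp iξ𝐀` on the set and for `1`.  Then the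
one-slot function `𝐀 ↦ E^{(j)}(X, exp iξ𝐀) := E(exp iξ𝐀, J(exp iξ𝐀))` is analytic at every `𝔤ᶜ`-valued Landau-gauge `𝐀` of the (4.4)-set.
[cite: Balaban1987RG1, (4.4) p.281] -/
theorem analyticOnNhd_E_sub310_one (𝓜 : Model 𝔸) {F : Frame P i 𝔸} {c : StepConsts}
    {π : 𝔸 →ₗ[ℂ] 𝔸} {Rop Pop : (Site P i → 𝔸) → (Site P i → 𝔸)} {α₀ α₁ α₂ Cπ : ℝ}
    (hξ : 0 < c.ξ) (hξ1 : c.ξ ≤ 1) (hcB : 0 < c.cB) (hα₀ : 0 < α₀) (hα₀1 : α₀ ≤ 1) (hα₂ : 0 ≤ α₂)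
    (hα₂q : α₂ ≤ 1 / 4) (hα₂α₁ : α₂ ≤ α₁) (h8 : 8 * α₂ < α₀) (hCπ : 0 ≤ Cπ) (hπn : ∀ X, ‖π X‖ ≤ Cπ * ‖X‖)
    (hπgc : ∀ X, π X ∈ 𝓜.gc) (hgcAd : ∀ g ∈ 𝓜.Gc, ∀ X ∈ 𝓜.gc, R g X ∈ 𝓜.gc) (heGc : ∀ a ∈ 𝓜.gc, expI c.ξ a ∈ 𝓜.Gc)
    (hRP : ∀ f : Site P i → 𝔸, Rop f + Pop f = f)
    (hres : (2 + (P.d - 1) * (Cπ * (C311 1 + 2 * 1 ^ 14))) * α₂ ≤ α₀)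
    (E : (PBond P i → 𝔸) × (PBond P i → 𝔸) → V)
    (hE : ∀ Φ ∈ space' 𝓜 F c α₀ α₁, AnalyticAt ℂ E ((fun b => (Φ.U b : 𝔸)), Φ.J))
    (hIV₁ : CondIV F.bg F.X₂ c α₀ (1 : PBond P i → 𝔸ˣ))
    (hIV : ∀ A ∈ space44 π Pop c.ξ α₂, CondIV F.bg F.X₂ c α₀ (sub310 c.ξ A (1 : PBond P i → 𝔸ˣ))) :
    AnalyticOnNhd ℂ (fun A : PBond P i → 𝔸 =>
      E ((fun b => ((ofBackground π c.ξ (sub310 c.ξ A (1 : PBond P i → 𝔸ˣ))).U b : 𝔸)),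
        (ofBackground π c.ξ (sub310 c.ξ A (1 : PBond P i → 𝔸ˣ))).J))
      (space44 π Pop c.ξ α₂ ∩ {A | (∀ b, A b ∈ 𝓜.gc) ∧
        Rop (fun y => ((c.ξ : ℂ)⁻¹) • divB (torusT P i) (dirForm (1 : PBond P i → 𝔸ˣ)) (dirForm A) y) = 0}) := by
  rintro A₀ ⟨hA, hAgc, hL⟩
  exact analyticAt_E_sub310_one_of_mem 𝓜 hπn E hE A₀
    (ofBackground_sub310_one_mem_space' 𝓜 hξ hξ1 hcB hα₀ hα₀1 hα₂ hα₂q hα₂α₁ h8 hCπ hπn hπgc hgcAd heGc hRP hres hA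
      hAgc hL (hIV A₀ hA) hIV₁)

end Sentence

end

end Literature.MathematicalPhysics.QuantumFieldTheory.Balaban1983to89.B12Eq44Space
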